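import Summits.QuantumFields.BalabanUV.T4Continuum.Support.NE9CurOfOneInstanceChartEndSmallBonds
import Literature.MathematicalPhysics.QuantumFieldTheory.Balaban1983to89.B11Eq98V0LettersUniform

/-!
# NE9CurOfOneInstanceChartEndModel — T25 READ AT THE END FACE FOR EVERY UNIT-BOUNDED UNITARY SMALL-BOND BACKGROUND OF A FIXED LATTICE WITH NO
# PER-BACKGROUND ANALYTIC HYPOTHESIS LEFT: (SB-C) §2 `Support/NE9CurOfOneInstanceChartEndSmallBonds.…_of_small_bonds_unitary` (this lineage, gen 69)
# with its last per-background display — the V₀-slot `hqV : ‖curV0 ρ τc U Y‖ ≤ C_V‖Y‖²` on `‖Y‖ < R_V` at FIXED `(C_V, R_V)` — PRODUCED by this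
# lineage's `B11Eq98V0LettersUniform.exists_curV0_quadBound_uniform` (gen 69: ONE `C_V` before `∀ U` on the unit-bounded unitary class, `R_V = 1/16`,
# from a tracial, `*`-compatible, contractive current trace `τc`); cell `pub-balaban`, T4-DAG §2 node U3 ∕ §6 NE9, route R2′ of `t4/ROUTES-NE9.md`;
# NE9 crux-team leaf lineage `b2b-balaban-t4-ne9-formalise-leaf-05`, generation 69; Summits-side NEW leaf under this seat's INTERFACE REQUEST NE9 of
# this generation (a separate file: (SB-C) has 321 l. — the 400-line rule); nothing printed asserted

HONEST FRAMING (T4-DAG PAGE 1).  Rung (B)+1 of the FINITE-VOLUME T⁴ programme — NOT infinite volume, NOT a mass gap, NOT the Clay problem.  NE9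
(`T4OutputRate.NE9` ∧ `FadingMemory`) is a cell NEW ESTIMATE, NOT PRINTED in [I] = [Balaban1987RG1] (CMP **109**), [II] = [Balaban1988RG2Cluster]
(CMP **116**), and NOT PROVED here («NE9 ⇐ the named binders»; spine PROVED 0∕9).  HONEST DEPENDENCY (cell line, verbatim): continuum YM on T⁴ ⇐
BetaPertH ∧ nine spine estimates (0/9 proved); BetaPertH ⇐ (D1) ∧ (D4) ∧ CAP+tail; G-an2-4 gates asym, D1 and NE2/3/4.  The `cur U` OBJECT is ONE
item of the MODEL O-NE9-1 (species (a) data); the END's `act` ∕ `ker` halves and NEEDS-COORDINATOR #5 are untouched.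

WHAT THIS FILE PROVES (TWO theorems + two [folklore] helpers; 0 def, 0 sorry, axioms standard).  **`termSize_ne9_and_fadingMemory_compCur_of_oneInstance_smallJ_model`** —
given the MODEL LETTERS ONLY (the lattice `(L, m)`, `1 ≤ L`; the fibre∕L²-trace letters `φ, M_φ, M_φ′, τ, C_τ` with `τ` tracial and
`⟨φ⁻¹X, φ⁻¹Y⟩ = τ(X*Y)`; the levels; `0 < a`; the fixed (L3) operators `ρ`, `τc` with `τc` tracial, `*`-compatible and contractive; current bounds
`M_J > 0`, `M_Δ ≥ 0`) and END-COMP's binders NOT mentioning the curve datum VERBATIM, THERE ARE `ε₃ > 0` (`≤ ε_reg(d, L)`), T-slot radii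
`a_C, ε_C > 0`, chart radii `ε₄, R_b, R′ > 0` and a current threshold `0 < j₁ ≤ M_J` — ALL BEFORE `∀ U` — such that for EVERY background `U` with
**`U(b) ∈ U1`, `U(b)* = U(b)⁻¹`, `‖U(b) − 1‖ ≤ ε ≤ ε₃`** (and `ε ≤ ε_reg`, implied) — AND NOTHING ELSE ABOUT `U` — and ALL currents with `‖J‖₍₋₃₎ ≤ j₁`,
`‖Δπ‖ ≤ M_Δ`: `hpos(U)` HOLDS and, for ALL per-domain readings `ιr X`, `πr X` with inclusions against the FIXED radii, every `Φ` agreeing with the read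
one-instance chart, and the six END-COMP binders mentioning `Dd.compCur Φ R₁`, the END face `TermSize ∧ NE9 ∧ FadingMemory` holds with (C″)'s
moduli VERBATIM — «⇐ the named binders».
§2 **`…_model_cstar`**: under `[CStarRing 𝔸]` the binder `U(b) ∈ U1` is PRODUCED from unitarity (`mem_U1_of_unitary`, Mathlib's
`CStarRing.norm_of_mem_unitary`): the background enters through **`U(b)* = U(b)⁻¹`, `‖U(b) − 1‖ ≤ ε ≤ ε₃`** ONLY.
MECHANISM: `exists_curV0_quadBound_uniform ρ τc …` gives `(C_V, 1/16)` before `∀ U`; (SB-C) §2 at those letters; its `hqV` display fed by the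
produced bound at each `U` (12 proof lines); §2 = §1 ∘ `mem_U1_of_unitary`.
DISGUISE TEST: composition by name; no inequality of the series proved; per LATTICE (`ε_reg`, `ε₃`, radii, threshold, `C_V` are finite-lattice
numbers); NOT print's local-gauge regularity class [Balaban1985BackgroundPropagators] (3.35)–(3.36) p. 396 nor [Balaban1987RG1] (1.11)–(1.12) p. 262
(uniform `α₀`, a small gauge on each cube) — bond-wise smallness in the GIVEN gauge; NOT Thms 3.12∕3.13; NOT (98)'s «d and L only»; NOT claimed that
Bałaban's 𝐇_k ∕ U_j(□₀, exp iB) ∕ U^c_j meet the readings' ball inclusions or END-COMP's displayed binders (O-NE9-1 ∕ O-NE9-5; #5 UNRULED); not NE9.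
References (TYPES ∕ loci only): [Balaban1985Variational] (31) p. 282, (38) p. 284, (45)–(47) p. 285, (90)–(96) pp. 291–292, Prop. 4 (97)–(98)
pp. 292–293, Prop. 6 (117)–(121) p. 295, (172)–(175) p. 305; [Balaban1985BackgroundPropagators] (3.5) p. 391, (3.35)–(3.36) p. 396, Thm 3.11 p. 416,
(3.126) p. 420, (3.153) p. 426; [Balaban1985Averaging] (42) p. 23, Prop. 3 (121)–(126) p. 36; [Balaban1987RG1] (1.11)–(1.14) p. 262, (1.18) p. 256,
Lemma 4 (3.53) p. 280; [Balaban1988RG2Cluster] Lemma 1 (1.36), Lemma 2 (1.41)–(1.43), (2.15)–(2.22).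
Imports (SB-C) `Support/NE9CurOfOneInstanceChartEndSmallBonds` and `B11Eq98V0LettersUniform` (both this lineage, gen 69) ONLY; modifies nothing; no
END re-wired.  Value = route R2′ bookkeeping at rung (B)+1 (T25's END face with the background displayed through three structural binders and one
smallness number), NOT summit progress.
-/

noncomputable section

namespace Summit.QuantumFields.BalabanUV.T4Continuum.NE9CurOfOneInstanceChartEndModel


open scoped BigOperators InnerProductSpace
open Metric Set
open Literature.MathematicalPhysics.QuantumFieldTheory.Balaban1983to89
open Literature.MathematicalPhysics.QuantumFieldTheory.Balaban1983to89.T4OutputRate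
open Literature.MathematicalPhysics.QuantumFieldTheory.Balaban1983to89.T4HistoryLipschitzRecursion
open Literature.MathematicalPhysics.QuantumFieldTheory.Balaban1983to89.T4HistoryLipschitzOuter
open Literature.MathematicalPhysics.QuantumFieldTheory.Balaban1983to89.T4HistoryLipschitzActivity
open Literature.MathematicalPhysics.QuantumFieldTheory.Balaban1983to89.T4HistoryLipschitzActivity (ClusterGeom)
open Literature.MathematicalPhysics.QuantumFieldTheory.Balaban1983to89.T4HistoryLipschitzSegment
open Summit.QuantumFields.BalabanUV.T4Continuum.NE9Lemma1Counting
open Summit.QuantumFields.BalabanUV.T4Continuum.NE9Lemma1Gain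
open Summit.QuantumFields.BalabanUV.T4Continuum.NE9Lemma1PieceClass
open Summit.QuantumFields.BalabanUV.T4Continuum.NE9Lemma1RemainderSpecies
open Summit.QuantumFields.BalabanUV.T4Continuum.NE9Lemma1CurveSpecies
open Summit.QuantumFields.BalabanUV.T4Continuum.NE9ComplexEncoding (doubleCarriers)
open Summit.QuantumFields.BalabanUV.T4Continuum.NE9LastCouplingBridge
open Summit.QuantumFields.BalabanUV.T4Continuum.NE9BridgeSizeInduction
open Summit.QuantumFields.BalabanUV.T4Continuum.NE9MarginalProjection
open Summit.QuantumFields.BalabanUV.T4Continuum.NE9MarginalProjectionEnd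
open Summit.QuantumFields.BalabanUV.T4Continuum.NE9CurveFromBackgroundMap
open Summit.QuantumFields.BalabanUV.T4Continuum.NE9CurveFromBackgroundMapEnd (termSize_ne9_and_fadingMemory_compCur_margProj_cpieceForm)
open Summit.QuantumFields.BalabanUV.T4Continuum.NE9CurOfB11Chart (triple_read)
open B11Eq103H1Complex B11Eq115Space B11Eq174Chart
open B11Eq111FrakG (nabla115)
open B9Eq319QprimeTorus (fineP)
open B9SectCLatticeCarrier (Bond)
open B4Sect5Torus (TSite)
open B7Prop1Explicit (U1 Wcx boxVec)
open B9Eq315QTorus (perCfg cornerSite QtorusW laplaceAofBackground)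
open B9Eq315QTorusOnto (QtorusW_surjective)
open B9Eq310HessianOperator (adTransportW)
open B11Eq44COperatorTorus (Cc)
open B11Eq63V0GroupCurrent (curV0)
open B11Eq80Current (W80)
open B11Eq79LinearTerm (LJ)
open Summit.QuantumFields.BalabanUV.T4Continuum.NE9CurOfOneInstanceChartEndSmallBonds
  (termSize_ne9_and_fadingMemory_compCur_of_oneInstance_smallJ_of_small_bonds_unitary)
open B9Eq335SmallBondsData (perCfg_mem_U1 hreg_of_small_bonds alpha_le_64 alphaL_le_half)
open B11Eq98V0LettersUniform (exists_curV0_quadBound_uniform)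

variable {C₀ : Carriers} {E : Type} [NormedAddCommGroup E] [NormedSpace ℂ E] {ι' αι β γ δ : Type} [DecidableEq δ]

variable (G : ClusterGeom (doubleCarriers C₀)) {Pot : Type*} [NormedAddCommGroup Pot] [NormedSpace ℂ Pot]

section Model

set_option maxRecDepth 8192 in
/-- **T25 AT THE END FACE FOR EVERY UNIT-BOUNDED UNITARY SMALL-BOND BACKGROUND — THE BACKGROUND ENTERS THROUGH `U(b) ∈ U1`, `U(b)* = U(b)⁻¹`,
`‖U(b) − 1‖ ≤ ε ≤ ε₃` AND NOTHING ELSE**: (SB-C) §2 with its V₀-slot display `hqV` at `(C_V, R_V)` PRODUCED (`exists_curV0_quadBound_uniform`: one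
`C_V` before `∀ U`, `R_V = 1/16`; letters `τc` tracial, `*`-compatible, contractive); `∃ ε₃ (≤ ε_reg) a_C ε_C ε₄ R_b R′ j₁` BEFORE `∀ U`, `hpos(U)`
PRODUCED, the readings' inclusions against FIXED radii, the six curve-datum binders and the 45 other END-COMP arguments VERBATIM, conclusion
`TermSize ∧ NE9 ∧ FadingMemory` «⇐ the named binders». [folklore] -/
theorem termSize_ne9_and_fadingMemory_compCur_of_oneInstance_smallJ_model {d : ℕ} (L : ℕ) [NeZero L] (m : Fin d → ℕ)
    [∀ i, NeZero (fineP L m i)] (hL : 1 ≤ L)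
    {𝔸 : Type*} [NormedRing 𝔸] [NormedAlgebra ℂ 𝔸] [CompleteSpace 𝔸] [NormOneClass 𝔸] [StarRing 𝔸] [NormedStarGroup 𝔸] [StarModule ℂ 𝔸]
    [FiniteDimensional ℂ 𝔸]
    {W : Type*} [NormedAddCommGroup W] [InnerProductSpace ℂ W] [FiniteDimensional ℂ W] (φ : W ≃ₗ[ℂ] 𝔸) {Mφ Mφ' : ℝ} (hMφ : 0 ≤ Mφ)
    (hMφ' : 0 ≤ Mφ') (hφ : ∀ w, ‖φ w‖ ≤ Mφ * ‖w‖) (hφ' : ∀ X, ‖φ.symm X‖ ≤ Mφ' * ‖X‖)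
    (τ : 𝔸 →ₗ[ℂ] ℂ) {Cτ : ℝ} (hτ : ∀ X, ‖τ X‖ ≤ Cτ * ‖X‖) (hCτ : 0 ≤ Cτ)
    (hτφ : ∀ X Y : 𝔸, inner ℂ (φ.symm X) (φ.symm Y) = τ (star X * Y)) (htr : ∀ X Y : 𝔸, τ (X * Y) = τ (Y * X))
    {η : ℝ} [Fact (0 < (L : ℝ))] [Fact (0 < η)] {lev₀ : Bond d (fineP L m) → ℕ} {levB : Bond d m → ℕ} (lev₁ : Bond d (fineP L m) × Fin d → ℕ)
    (hlev : ∀ b, 1 ≤ lev₀ b) {c₀ c₁ : ℝ} [Fact (0 < c₀)] [Fact (0 < c₁)] {a : ℝ} (ha : 0 < a)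
    (ρ : (𝔸 →L[ℂ] ℂ) →L[ℂ] 𝔸) (τc : 𝔸 →L[ℂ] ℂ) (hτc : ∀ a b : 𝔸, τc (a * b) = τc (b * a))
    (hτcs : ∀ a : 𝔸, τc (star a) = starRingEnd ℂ (τc a)) (hτc1 : ∀ X : 𝔸, ‖τc X‖ ≤ ‖X‖) {MJ MΔ : ℝ} (hMJ : 0 < MJ) (hMΔ : 0 ≤ MΔ)
    -- END-COMP's binders NOT mentioning the curve datum, verbatim (bound names as in the module docstring)
    {Dd : RemData C₀ E ι' αι β γ δ} {R₁ : C₀.Dom → ℝ} {ℓg : ℕ → ℕ → ℝ} {cdir d0 : ℝ}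
    {Ef : Functional (doubleCarriers C₀) E} {Wd : Set (ℕ → ℝ)} {Adm S : Set (E → (doubleCarriers C₀).Dom → ℝ)}
    {r : ℕ → (E → (doubleCarriers C₀).Dom → ℝ) → ℝ} {A : E → (doubleCarriers C₀).Dom → ℝ}
    {ΨF : ℕ → ℝ → (ι' → ℝ) → E → (doubleCarriers C₀).Dom → ℝ} {act : ℕ → ℝ → E → Pot → G.P → ℂ} {𝒜 : ℕ → Set Pot}
    {n : ℕ → ℝ → E → G.P → ℝ} {lip clip : ℕ → ℝ} {aP dP : G.P → ℝ} {δv : (doubleCarriers C₀).Dom → ℝ}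
    {κw O1 cQ ω clipd Nbar B lipbar clipbar cr aA : ℝ} {p₀ N : ℕ → ℝ}
    (ρP : ℕ → (ι' → ℝ) → Pot) (U₀ : E) (explZ : ℕ → E → (doubleCarriers C₀).Dom → ℝ) (h0 : ScaleZeroFree Ef Wd)
    (hAdm : AdmissibleTerms Ef Wd Adm) (hres : AdmRestrict Adm)
    (hDd : Dd.Admissible ℓg cdir d0) (hdirB0 : ∀ k s y a' b x, 0 < Dd.dirB k s y a' b x)
    (hdirC : ∀ k s y a' b x, Continuous fun p : ℂ × (δ → ℝ) × (δ → ℂ) => Dd.dir k s y a' b x p.1 p.2.1 p.2.2)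
    (hdirB : ∀ k s y a' b x t s' σ', ‖Dd.dir k s y a' b x t s' σ'‖ ≤ Dd.dirB k s y a' b x)
    (hrA : ReadAdditive Adm r) (hr0 : ReadZero r) (hrs : ReadSize Adm r κw cr) (hA : DirSize A κw aA) (hcr : 0 ≤ cr)
    (haA : 0 ≤ aA)
    (hAmul : ∀ c : ℕ → ℝ, (fun U X' => c ((doubleCarriers C₀).scale X') * A U X') ∈ Adm)
    (hcoef : ∀ (j : ℕ) (c : ℝ), r j (restrictScale j (c • A)) = c * r j (restrictScale j A))
    (hnorm : ∀ j : ℕ, r j (restrictScale j A) = 1 ∨ ∀ H ∈ Adm, r j (restrictScale j H) = 0)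
    (hS : ∀ H ∈ Adm, margProj r A H ∈ S)
    (hclipd : 0 ≤ clipd) (hcdir : 0 < cdir) (hℓpos : ∀ k j, 0 < ℓg k j) (hhalf : ∀ k j, cdir * ℓg k j < 1 / 2)
    (hcont : ∀ (k : ℕ) (s : ℕ → ℝ) (y : ι') (a' : αι) (b : β) (x : (doubleCarriers C₀).Dom),
      ContinuousOn (fun p : ℂ × ((δ → ℝ) × (δ → ℂ)) => Dd.dir k s y a' b x p.1 p.2.1 p.2.2)
        (sphere (0:ℂ) (Dd.r k) ×ˢ {q | OnContour Dd.κ₁ (Dd.cubes k y a' b) q.1 q.2}))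
    (hlip : ∀ g ∈ Wd, ∀ g' ∈ Wd, ∀ (k : ℕ) (y : ι'), ∀ a' ∈ Dd.S0 k y, ∀ b ∈ Dd.SY k y a', ∀ (j : ℕ), ∀ x ∈ Dd.src k y a' j,
      ∀ t ∈ sphere (0:ℂ) (Dd.r k), ∀ (s' : δ → ℝ) (σ' : δ → ℂ), OnContour Dd.κ₁ (Dd.cubes k y a' b) s' σ' →
        ‖Dd.dir k g y a' b x t s' σ' - Dd.dir k g' y a' b x t s' σ'‖ ≤ clipd * (cdir * ℓg k j * Dd.R x.1) * |g k - g' k|)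
    (hO1 : 0 ≤ O1) (hcQ : 0 ≤ cQ) (hω0 : 0 ≤ ω) (hω1 : ω < 1) (hNb : ∀ j, N j ≤ Nbar) (hclip0 : ∀ k, 0 ≤ clip k)
    (hCup : ∀ g ∈ Wd, ∀ g' ∈ Wd, ∀ (k : ℕ) (Ue : E) (X : (doubleCarriers C₀).Dom), (doubleCarriers C₀).scale X = k + 1 →
      ∀ Q ∈ 𝒜 k, ∀ γ' ∈ G.vol X,
      ‖act k (g k) Ue Q γ'‖ ≤ n k (g' k) Ue γ' ∧
        ‖act k (g k) Ue Q γ' - act k (g' k) Ue Q γ'‖ ≤ clip k * |g k - g' k| * n k (g' k) Ue γ')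
    (hreprV : ∀ (k : ℕ) (s : ℝ) (Q : ι' → ℝ) (Ue : E) (X : (doubleCarriers C₀).Dom),
      ΨF k s Q Ue X = (G.newTerm act k s Ue X (ρP k Q)).re - (G.newTerm act k s U₀ X (ρP k Q)).re + explZ k Ue X)
    (hclipb : ∀ k, clip k ≤ clipbar)
    (hK : TwoPointKP G Wd act 𝒜 n lip aP dP) (hdec : G.DecayExtract δv dP) (hpin : G.PinBudget aP δv (fun _ => B) κw)
    (hexplZ : ∀ (k : ℕ) (Ue : E) (X : (doubleCarriers C₀).Dom), (doubleCarriers C₀).scale X = k + 1 →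
      |explZ k Ue X| ≤ Real.exp (-(κw * (doubleCarriers C₀).d X)) * p₀ k)
    (hbase : ∀ g ∈ Wd, ∀ (Ue : E) (X : (doubleCarriers C₀).Dom), (doubleCarriers C₀).scale X = 0 →
      |Ef g Ue X| ≤ Real.exp (-(κw * (doubleCarriers C₀).d X)) * N 0)
    (hNsucc : ∀ j, p₀ j + 2 * B ≤ N (j + 1)) (hNnn : ∀ j, 0 ≤ N j)
    (hB : 0 ≤ B) (hlipb : ∀ k, lip k ≤ lipbar) (hpos' : 0 < ω + 8 * lipbar * B * ((1 + cr * aA) * cQ)) :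
    ∃ ε₃ aC εC ε₄ Rb R' j₁ : ℝ, 0 < ε₃ ∧ ε₃ ≤ 1 / (256 * ((d : ℝ) + 1) ^ 2 * (L : ℝ) ^ (d + 1)) ∧
      0 < aC ∧ 0 < εC ∧ 0 < ε₄ ∧ 0 < Rb ∧ 0 < R' ∧ 0 < j₁ ∧ j₁ ≤ MJ ∧
      ∀ (U : Bond d (fineP L m) → 𝔸ˣ) (hU : ∀ b, U b ∈ U1 𝔸) {ε : ℝ} (hε : 0 ≤ ε)
      (hεr : ε ≤ 1 / (256 * ((d : ℝ) + 1) ^ 2 * (L : ℝ) ^ (d + 1))), ε ≤ ε₃ → ∀ (hUε : ∀ b, ‖(U b : 𝔸) - 1‖ ≤ ε),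
      (∀ b, star (U b : 𝔸) = (((U b)⁻¹ : 𝔸ˣ) : 𝔸)) →
      ∀ (J : NegSize (L : ℝ) η lev₀ 3 𝔸) (Δπ : Space115 (L : ℝ) η lev₀ lev₁ (nabla115 η U) →L[ℂ] NegSize (L : ℝ) η lev₀ 3 𝔸),
        ‖J‖ ≤ j₁ → ‖Δπ‖ ≤ MΔ →
      ∃ hpos : ∀ x : BondL2K ℂ d (fineP L m) c₀ W, x ≠ 0 →
          0 < RCLike.re (inner ℂ x (laplaceAofBackground L m hL φ U (alpha_le_64 hL hε hεr) (perCfg_mem_U1 L m hU)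
            (hreg_of_small_bonds L m hU hε hUε) τ η (c₀ := c₀) (c₁ := c₁) a x)),
      let Hc := H1LatticeCLM (lev₀ := lev₀) (levB := levB) φ hpos (QtorusW_surjective L m hL U (alpha_le_64 hL hε hεr) (perCfg_mem_U1 L m hU)
        (hreg_of_small_bonds L m hU hε hUε) (alphaL_le_half hL hεr) φ) lev₁ (nabla115 η U)
      let Gc := frakGLatticeCLM (lev₀ := lev₀) φ hpos (QtorusW_surjective L m hL U (alpha_le_64 hL hε hεr) (perCfg_mem_U1 L m hU)
        (hreg_of_small_bonds L m hU hε hUε) (alphaL_le_half hL hεr) φ) lev₁ (nabla115 η U)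
      let Cx := Cc L m η U lev₀ lev₁ (nabla115 η U) levB
      ∀ (ιr : C₀.Dom → (E →L[ℂ] NegSize (L : ℝ) η levB 0 𝔸)) (πr : C₀.Dom → (Space115 (L : ℝ) η lev₀ lev₁ (nabla115 η U) →L[ℂ] E)),
          (∀ X, MapsTo (ιr X) (ball 0 (Dd.R X)) (ball 0 Rb)) → (∀ X, MapsTo (πr X) (ball 0 R') (ball 0 (R₁ X))) →
          ∀ (Φ : C₀.Dom → E → E), (∀ X e, Φ X e = πr X (chartHB Gc (-(Gc.comp (LJ ρ τc Hc Cx J))) (W80 ρ τc U Hc Cx εC J Δπ) 0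
              (fun A' => A' + solA Hc 0 Cx 0 εC A') ε₄ Hc (ιr X e))) →
          -- END-COMP's binders that mention the curve datum `Dd.compCur Φ R₁`
          LevelCountsG (Dd.compCur Φ R₁).toC.frame κw (Dd.compCur Φ R₁).κ₁ O1 cQ (fun k j => ℓg k j ^ 5) (agePow ω) →
          Adm ⊆ analyticClass (Dd.compCur Φ R₁).R → A ∈ analyticClass (Dd.compCur Φ R₁).R →
          Factorises Ef Wd (compProj (cpieceChannel (Dd.compCur Φ R₁).toC) (margProj r A)) ΨF →
          (∀ (k : ℕ) (Q Q' : ι' → ℝ) (M : ℝ),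
            (∀ y, |Q y - Q' y| ≤ weightOf (Dd.compCur Φ R₁).toC.frame (Dd.compCur Φ R₁).κ₁ d0 O1 ((Dd.compCur Φ R₁).Kp cdir) k y
              * M) → ‖ρP k Q - ρP k Q'‖ ≤ M) →
          (∀ (k : ℕ) (Q : ι' → ℝ),
            (∀ y, |Q y| ≤ weightOf (Dd.compCur Φ R₁).toC.frame (Dd.compCur Φ R₁).κ₁ d0 O1 ((Dd.compCur Φ R₁).Kp cdir) k y *
              sizeRadius (fun k j => (1 + cr * aA) * tauOfG cQ (agePow ω) k j) N k) → ρP k Q ∈ 𝒜 k) →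
          TermSize Ef Wd κw N ∧
            NE9 Ef Wd κw (prodModuli (8 * clipbar * B + 8 * lipbar * B *
                ((64 * (4 * clipd) * Nbar + cr * Nbar * (64 * (4 * clipd) * aA)) * cQ * (1 - ω)⁻¹))
              fun _ => ω + 8 * lipbar * B * ((1 + cr * aA) * cQ)) ∧
              FadingMemory ((8 * clipbar * B + 8 * lipbar * B *
                    ((64 * (4 * clipd) * Nbar + cr * Nbar * (64 * (4 * clipd) * aA)) * cQ * (1 - ω)⁻¹)) /
                  (ω + 8 * lipbar * B * ((1 + cr * aA) * cQ)))
                (ω + 8 * lipbar * B * ((1 + cr * aA) * cQ))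
                (prodModuli (8 * clipbar * B + 8 * lipbar * B *
                    ((64 * (4 * clipd) * Nbar + cr * Nbar * (64 * (4 * clipd) * aA)) * cQ * (1 - ω)⁻¹))
                  fun _ => ω + 8 * lipbar * B * ((1 + cr * aA) * cQ)) := by
  obtain ⟨CV, hCV, HV⟩ := exists_curV0_quadBound_uniform (L := (L : ℝ)) (η := η) (lev₀ := lev₀) (lev₁ := lev₁) (Pd := fineP L m) ρ τc hτc
    hτcs hτc1 (by exact_mod_cast hL)
  obtain ⟨ε₃, aC, εC, ε₄, Rb, R', j₁, hε₃, hle, haC, hεC, hε₄, hRb, hR', hj₁, hj₁M, H⟩ :=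
    termSize_ne9_and_fadingMemory_compCur_of_oneInstance_smallJ_of_small_bonds_unitary G L m hL φ hMφ hMφ' hφ hφ' τ hτ hCτ hτφ htr (η := η)
      (lev₀ := lev₀) (levB := levB) lev₁ hlev (c₀ := c₀) (c₁ := c₁) ha ρ τc hCV (by norm_num : (0 : ℝ) < 1 / 16) hMJ hMΔ ρP U₀ explZ h0 hAdm
      hres hDd hdirB0 hdirC hdirB hrA hr0 hrs hA hcr haA hAmul hcoef hnorm hS hclipd hcdir hℓpos hhalf hcont hlip hO1 hcQ hω0 hω1 hNb hclip0 hCup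
      hreprV hclipb hK hdec hpin hexplZ hbase hNsucc hNnn hB hlipb hpos'
  refine ⟨ε₃, aC, εC, ε₄, Rb, R', j₁, hε₃, hle, haC, hεC, hε₄, hRb, hR', hj₁, hj₁M, ?_⟩
  intro U hU ε hε hεr hεm hUε hUstar J Δπ hJ hΔ
  exact H U hU hε hεr hεm hUε hUstar (HV U hU hUstar) J Δπ hJ hΔ


/-! ## §2 In a C⋆-algebra the unit-boundedness is implied by unitarity: background binders {`U(b)* = U(b)⁻¹`, small bonds} only -/

/-- In a C⋆-algebra (`[CStarRing 𝔸]`, e.g. a matrix algebra in the operator norm) a unit with `u* = u⁻¹` is a unitary element, hence `‖u‖ = ‖u⁻¹‖ = 1`: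
`u ∈ U1` (Mathlib's `CStarRing.norm_of_mem_unitary`). [folklore] -/
theorem mem_U1_of_star_eq_inv {𝔸 : Type*} [NormedRing 𝔸] [NormOneClass 𝔸] [StarRing 𝔸] [NormedStarGroup 𝔸] [CStarRing 𝔸]
    {u : 𝔸ˣ} (hu : star (u : 𝔸) = ((u⁻¹ : 𝔸ˣ) : 𝔸)) : u ∈ U1 𝔸 := by
  haveI : Nontrivial 𝔸 := NormOneClass.nontrivial
  have hmem : (u : 𝔸) ∈ unitary 𝔸 := Unitary.mem_iff.2 ⟨by rw [hu, Units.inv_mul], by rw [hu, Units.mul_inv]⟩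
  have h1 : ‖(u : 𝔸)‖ = 1 := CStarRing.norm_of_mem_unitary hmem
  have h2 : ‖((u⁻¹ : 𝔸ˣ) : 𝔸)‖ = 1 := by rw [← hu, norm_star, h1]
  exact B7Prop1Explicit.mem_U1.2 ⟨h1.le, h2.le⟩

/-- The bond-wise form: a unitary bond field of a C⋆-algebra is `U1`-valued. [folklore] -/
theorem mem_U1_of_unitary {𝔸 : Type*} [NormedRing 𝔸] [NormOneClass 𝔸] [StarRing 𝔸] [NormedStarGroup 𝔸] [CStarRing 𝔸]
    {ι : Type*} {U : ι → 𝔸ˣ} (hUstar : ∀ b, star (U b : 𝔸) = (((U b)⁻¹ : 𝔸ˣ) : 𝔸)) : ∀ b, U b ∈ U1 𝔸 :=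
  fun b => mem_U1_of_star_eq_inv (hUstar b)

set_option maxRecDepth 8192 in
/-- **§2: THE SAME END FACE IN A C⋆-ALGEBRA — THE BACKGROUND ENTERS THROUGH `U(b)* = U(b)⁻¹` AND `‖U(b) − 1‖ ≤ ε ≤ ε₃` ONLY** (`U(b) ∈ U1` PRODUCED
by `mem_U1_of_unitary`; every other token of §1 verbatim, the unitarity binder moved in front of `ε`): T25's END face for every UNITARY ε-SMALL-BOND
lattice gauge field of a fixed lattice with values in a C⋆-algebra (Bałaban's `G ⊂ M_N(ℂ)` in the operator norm). [folklore] -/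
theorem termSize_ne9_and_fadingMemory_compCur_of_oneInstance_smallJ_model_cstar {d : ℕ} (L : ℕ) [NeZero L] (m : Fin d → ℕ)
    [∀ i, NeZero (fineP L m i)] (hL : 1 ≤ L)
    {𝔸 : Type*} [NormedRing 𝔸] [NormedAlgebra ℂ 𝔸] [CompleteSpace 𝔸] [NormOneClass 𝔸] [StarRing 𝔸] [NormedStarGroup 𝔸] [StarModule ℂ 𝔸]
    [CStarRing 𝔸] [FiniteDimensional ℂ 𝔸]
    {W : Type*} [NormedAddCommGroup W] [InnerProductSpace ℂ W] [FiniteDimensional ℂ W] (φ : W ≃ₗ[ℂ] 𝔸) {Mφ Mφ' : ℝ} (hMφ : 0 ≤ Mφ)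
    (hMφ' : 0 ≤ Mφ') (hφ : ∀ w, ‖φ w‖ ≤ Mφ * ‖w‖) (hφ' : ∀ X, ‖φ.symm X‖ ≤ Mφ' * ‖X‖)
    (τ : 𝔸 →ₗ[ℂ] ℂ) {Cτ : ℝ} (hτ : ∀ X, ‖τ X‖ ≤ Cτ * ‖X‖) (hCτ : 0 ≤ Cτ)
    (hτφ : ∀ X Y : 𝔸, inner ℂ (φ.symm X) (φ.symm Y) = τ (star X * Y)) (htr : ∀ X Y : 𝔸, τ (X * Y) = τ (Y * X))
    {η : ℝ} [Fact (0 < (L : ℝ))] [Fact (0 < η)] {lev₀ : Bond d (fineP L m) → ℕ} {levB : Bond d m → ℕ} (lev₁ : Bond d (fineP L m) × Fin d → ℕ)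
    (hlev : ∀ b, 1 ≤ lev₀ b) {c₀ c₁ : ℝ} [Fact (0 < c₀)] [Fact (0 < c₁)] {a : ℝ} (ha : 0 < a)
    (ρ : (𝔸 →L[ℂ] ℂ) →L[ℂ] 𝔸) (τc : 𝔸 →L[ℂ] ℂ) (hτc : ∀ a b : 𝔸, τc (a * b) = τc (b * a))
    (hτcs : ∀ a : 𝔸, τc (star a) = starRingEnd ℂ (τc a)) (hτc1 : ∀ X : 𝔸, ‖τc X‖ ≤ ‖X‖) {MJ MΔ : ℝ} (hMJ : 0 < MJ) (hMΔ : 0 ≤ MΔ)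
    -- END-COMP's binders NOT mentioning the curve datum, verbatim (bound names as in the module docstring)
    {Dd : RemData C₀ E ι' αι β γ δ} {R₁ : C₀.Dom → ℝ} {ℓg : ℕ → ℕ → ℝ} {cdir d0 : ℝ}
    {Ef : Functional (doubleCarriers C₀) E} {Wd : Set (ℕ → ℝ)} {Adm S : Set (E → (doubleCarriers C₀).Dom → ℝ)}
    {r : ℕ → (E → (doubleCarriers C₀).Dom → ℝ) → ℝ} {A : E → (doubleCarriers C₀).Dom → ℝ}
    {ΨF : ℕ → ℝ → (ι' → ℝ) → E → (doubleCarriers C₀).Dom → ℝ} {act : ℕ → ℝ → E → Pot → G.P → ℂ} {𝒜 : ℕ → Set Pot}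
    {n : ℕ → ℝ → E → G.P → ℝ} {lip clip : ℕ → ℝ} {aP dP : G.P → ℝ} {δv : (doubleCarriers C₀).Dom → ℝ}
    {κw O1 cQ ω clipd Nbar B lipbar clipbar cr aA : ℝ} {p₀ N : ℕ → ℝ}
    (ρP : ℕ → (ι' → ℝ) → Pot) (U₀ : E) (explZ : ℕ → E → (doubleCarriers C₀).Dom → ℝ) (h0 : ScaleZeroFree Ef Wd)
    (hAdm : AdmissibleTerms Ef Wd Adm) (hres : AdmRestrict Adm)
    (hDd : Dd.Admissible ℓg cdir d0) (hdirB0 : ∀ k s y a' b x, 0 < Dd.dirB k s y a' b x)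
    (hdirC : ∀ k s y a' b x, Continuous fun p : ℂ × (δ → ℝ) × (δ → ℂ) => Dd.dir k s y a' b x p.1 p.2.1 p.2.2)
    (hdirB : ∀ k s y a' b x t s' σ', ‖Dd.dir k s y a' b x t s' σ'‖ ≤ Dd.dirB k s y a' b x)
    (hrA : ReadAdditive Adm r) (hr0 : ReadZero r) (hrs : ReadSize Adm r κw cr) (hA : DirSize A κw aA) (hcr : 0 ≤ cr)
    (haA : 0 ≤ aA)
    (hAmul : ∀ c : ℕ → ℝ, (fun U X' => c ((doubleCarriers C₀).scale X') * A U X') ∈ Adm)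
    (hcoef : ∀ (j : ℕ) (c : ℝ), r j (restrictScale j (c • A)) = c * r j (restrictScale j A))
    (hnorm : ∀ j : ℕ, r j (restrictScale j A) = 1 ∨ ∀ H ∈ Adm, r j (restrictScale j H) = 0)
    (hS : ∀ H ∈ Adm, margProj r A H ∈ S)
    (hclipd : 0 ≤ clipd) (hcdir : 0 < cdir) (hℓpos : ∀ k j, 0 < ℓg k j) (hhalf : ∀ k j, cdir * ℓg k j < 1 / 2)
    (hcont : ∀ (k : ℕ) (s : ℕ → ℝ) (y : ι') (a' : αι) (b : β) (x : (doubleCarriers C₀).Dom),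
      ContinuousOn (fun p : ℂ × ((δ → ℝ) × (δ → ℂ)) => Dd.dir k s y a' b x p.1 p.2.1 p.2.2)
        (sphere (0:ℂ) (Dd.r k) ×ˢ {q | OnContour Dd.κ₁ (Dd.cubes k y a' b) q.1 q.2}))
    (hlip : ∀ g ∈ Wd, ∀ g' ∈ Wd, ∀ (k : ℕ) (y : ι'), ∀ a' ∈ Dd.S0 k y, ∀ b ∈ Dd.SY k y a', ∀ (j : ℕ), ∀ x ∈ Dd.src k y a' j,
      ∀ t ∈ sphere (0:ℂ) (Dd.r k), ∀ (s' : δ → ℝ) (σ' : δ → ℂ), OnContour Dd.κ₁ (Dd.cubes k y a' b) s' σ' →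
        ‖Dd.dir k g y a' b x t s' σ' - Dd.dir k g' y a' b x t s' σ'‖ ≤ clipd * (cdir * ℓg k j * Dd.R x.1) * |g k - g' k|)
    (hO1 : 0 ≤ O1) (hcQ : 0 ≤ cQ) (hω0 : 0 ≤ ω) (hω1 : ω < 1) (hNb : ∀ j, N j ≤ Nbar) (hclip0 : ∀ k, 0 ≤ clip k)
    (hCup : ∀ g ∈ Wd, ∀ g' ∈ Wd, ∀ (k : ℕ) (Ue : E) (X : (doubleCarriers C₀).Dom), (doubleCarriers C₀).scale X = k + 1 →
      ∀ Q ∈ 𝒜 k, ∀ γ' ∈ G.vol X,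
      ‖act k (g k) Ue Q γ'‖ ≤ n k (g' k) Ue γ' ∧
        ‖act k (g k) Ue Q γ' - act k (g' k) Ue Q γ'‖ ≤ clip k * |g k - g' k| * n k (g' k) Ue γ')
    (hreprV : ∀ (k : ℕ) (s : ℝ) (Q : ι' → ℝ) (Ue : E) (X : (doubleCarriers C₀).Dom),
      ΨF k s Q Ue X = (G.newTerm act k s Ue X (ρP k Q)).re - (G.newTerm act k s U₀ X (ρP k Q)).re + explZ k Ue X)
    (hclipb : ∀ k, clip k ≤ clipbar)
    (hK : TwoPointKP G Wd act 𝒜 n lip aP dP) (hdec : G.DecayExtract δv dP) (hpin : G.PinBudget aP δv (fun _ => B) κw)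
    (hexplZ : ∀ (k : ℕ) (Ue : E) (X : (doubleCarriers C₀).Dom), (doubleCarriers C₀).scale X = k + 1 →
      |explZ k Ue X| ≤ Real.exp (-(κw * (doubleCarriers C₀).d X)) * p₀ k)
    (hbase : ∀ g ∈ Wd, ∀ (Ue : E) (X : (doubleCarriers C₀).Dom), (doubleCarriers C₀).scale X = 0 →
      |Ef g Ue X| ≤ Real.exp (-(κw * (doubleCarriers C₀).d X)) * N 0)
    (hNsucc : ∀ j, p₀ j + 2 * B ≤ N (j + 1)) (hNnn : ∀ j, 0 ≤ N j)
    (hB : 0 ≤ B) (hlipb : ∀ k, lip k ≤ lipbar) (hpos' : 0 < ω + 8 * lipbar * B * ((1 + cr * aA) * cQ)) :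
    ∃ ε₃ aC εC ε₄ Rb R' j₁ : ℝ, 0 < ε₃ ∧ ε₃ ≤ 1 / (256 * ((d : ℝ) + 1) ^ 2 * (L : ℝ) ^ (d + 1)) ∧
      0 < aC ∧ 0 < εC ∧ 0 < ε₄ ∧ 0 < Rb ∧ 0 < R' ∧ 0 < j₁ ∧ j₁ ≤ MJ ∧
      ∀ (U : Bond d (fineP L m) → 𝔸ˣ) (hUstar : ∀ b, star (U b : 𝔸) = (((U b)⁻¹ : 𝔸ˣ) : 𝔸)) {ε : ℝ} (hε : 0 ≤ ε)
      (hεr : ε ≤ 1 / (256 * ((d : ℝ) + 1) ^ 2 * (L : ℝ) ^ (d + 1))), ε ≤ ε₃ → ∀ (hUε : ∀ b, ‖(U b : 𝔸) - 1‖ ≤ ε),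
      ∀ (J : NegSize (L : ℝ) η lev₀ 3 𝔸) (Δπ : Space115 (L : ℝ) η lev₀ lev₁ (nabla115 η U) →L[ℂ] NegSize (L : ℝ) η lev₀ 3 𝔸),
        ‖J‖ ≤ j₁ → ‖Δπ‖ ≤ MΔ →
      ∃ hpos : ∀ x : BondL2K ℂ d (fineP L m) c₀ W, x ≠ 0 →
          0 < RCLike.re (inner ℂ x (laplaceAofBackground L m hL φ U (alpha_le_64 hL hε hεr) (perCfg_mem_U1 L m (mem_U1_of_unitary hUstar))
            (hreg_of_small_bonds L m (mem_U1_of_unitary hUstar) hε hUε) τ η (c₀ := c₀) (c₁ := c₁) a x)),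
      let Hc := H1LatticeCLM (lev₀ := lev₀) (levB := levB) φ hpos (QtorusW_surjective L m hL U (alpha_le_64 hL hε hεr) (perCfg_mem_U1 L m (mem_U1_of_unitary hUstar))
        (hreg_of_small_bonds L m (mem_U1_of_unitary hUstar) hε hUε) (alphaL_le_half hL hεr) φ) lev₁ (nabla115 η U)
      let Gc := frakGLatticeCLM (lev₀ := lev₀) φ hpos (QtorusW_surjective L m hL U (alpha_le_64 hL hε hεr) (perCfg_mem_U1 L m (mem_U1_of_unitary hUstar))
        (hreg_of_small_bonds L m (mem_U1_of_unitary hUstar) hε hUε) (alphaL_le_half hL hεr) φ) lev₁ (nabla115 η U)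
      let Cx := Cc L m η U lev₀ lev₁ (nabla115 η U) levB
      ∀ (ιr : C₀.Dom → (E →L[ℂ] NegSize (L : ℝ) η levB 0 𝔸)) (πr : C₀.Dom → (Space115 (L : ℝ) η lev₀ lev₁ (nabla115 η U) →L[ℂ] E)),
          (∀ X, MapsTo (ιr X) (ball 0 (Dd.R X)) (ball 0 Rb)) → (∀ X, MapsTo (πr X) (ball 0 R') (ball 0 (R₁ X))) →
          ∀ (Φ : C₀.Dom → E → E), (∀ X e, Φ X e = πr X (chartHB Gc (-(Gc.comp (LJ ρ τc Hc Cx J))) (W80 ρ τc U Hc Cx εC J Δπ) 0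
              (fun A' => A' + solA Hc 0 Cx 0 εC A') ε₄ Hc (ιr X e))) →
          -- END-COMP's binders that mention the curve datum `Dd.compCur Φ R₁`
          LevelCountsG (Dd.compCur Φ R₁).toC.frame κw (Dd.compCur Φ R₁).κ₁ O1 cQ (fun k j => ℓg k j ^ 5) (agePow ω) →
          Adm ⊆ analyticClass (Dd.compCur Φ R₁).R → A ∈ analyticClass (Dd.compCur Φ R₁).R →
          Factorises Ef Wd (compProj (cpieceChannel (Dd.compCur Φ R₁).toC) (margProj r A)) ΨF →
          (∀ (k : ℕ) (Q Q' : ι' → ℝ) (M : ℝ),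
            (∀ y, |Q y - Q' y| ≤ weightOf (Dd.compCur Φ R₁).toC.frame (Dd.compCur Φ R₁).κ₁ d0 O1 ((Dd.compCur Φ R₁).Kp cdir) k y
              * M) → ‖ρP k Q - ρP k Q'‖ ≤ M) →
          (∀ (k : ℕ) (Q : ι' → ℝ),
            (∀ y, |Q y| ≤ weightOf (Dd.compCur Φ R₁).toC.frame (Dd.compCur Φ R₁).κ₁ d0 O1 ((Dd.compCur Φ R₁).Kp cdir) k y *
              sizeRadius (fun k j => (1 + cr * aA) * tauOfG cQ (agePow ω) k j) N k) → ρP k Q ∈ 𝒜 k) →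
          TermSize Ef Wd κw N ∧
            NE9 Ef Wd κw (prodModuli (8 * clipbar * B + 8 * lipbar * B *
                ((64 * (4 * clipd) * Nbar + cr * Nbar * (64 * (4 * clipd) * aA)) * cQ * (1 - ω)⁻¹))
              fun _ => ω + 8 * lipbar * B * ((1 + cr * aA) * cQ)) ∧
              FadingMemory ((8 * clipbar * B + 8 * lipbar * B *
                    ((64 * (4 * clipd) * Nbar + cr * Nbar * (64 * (4 * clipd) * aA)) * cQ * (1 - ω)⁻¹)) /
                  (ω + 8 * lipbar * B * ((1 + cr * aA) * cQ)))
                (ω + 8 * lipbar * B * ((1 + cr * aA) * cQ))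
                (prodModuli (8 * clipbar * B + 8 * lipbar * B *
                    ((64 * (4 * clipd) * Nbar + cr * Nbar * (64 * (4 * clipd) * aA)) * cQ * (1 - ω)⁻¹))
                  fun _ => ω + 8 * lipbar * B * ((1 + cr * aA) * cQ)) := by
  obtain ⟨ε₃, aC, εC, ε₄, Rb, R', j₁, hε₃, hle, haC, hεC, hε₄, hRb, hR', hj₁, hj₁M, H⟩ :=
    termSize_ne9_and_fadingMemory_compCur_of_oneInstance_smallJ_model G L m hL φ hMφ hMφ' hφ hφ' τ hτ hCτ hτφ htr (η := η) (lev₀ := lev₀)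
      (levB := levB) lev₁ hlev (c₀ := c₀) (c₁ := c₁) ha ρ τc hτc hτcs hτc1 hMJ hMΔ ρP U₀ explZ h0 hAdm hres hDd hdirB0 hdirC hdirB hrA hr0 hrs hA
      hcr haA hAmul hcoef hnorm hS hclipd hcdir hℓpos hhalf hcont hlip hO1 hcQ hω0 hω1 hNb hclip0 hCup hreprV hclipb hK hdec hpin hexplZ hbase
      hNsucc hNnn hB hlipb hpos'
  refine ⟨ε₃, aC, εC, ε₄, Rb, R', j₁, hε₃, hle, haC, hεC, hε₄, hRb, hR', hj₁, hj₁M, ?_⟩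
  intro U hUstar ε hε hεr hεm hUε J Δπ hJ hΔ
  exact H U (mem_U1_of_unitary hUstar) hε hεr hεm hUε hUstar J Δπ hJ hΔ

end Model

end Summit.QuantumFields.BalabanUV.T4Continuum.NE9CurOfOneInstanceChartEndModel

end
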